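import Literature.MathematicalPhysics.KineticTheory.IllnerPulvirentiDispersionDecay
import Literature.MathematicalPhysics.KineticTheory.HierarchyContinuityEstimates
import Literature.MathematicalPhysics.KineticTheory.IllnerShinbrotCollisionEstimates
import Literature.MathematicalPhysics.KineticTheory.BoltzmannSolutionsUkaiVelocity
import HarnessLib

/-!
# Dispersive single-step estimates for the Boltzmann hierarchy on `ℝ^d` (CIP 1994 §4.5 (5.2)–(5.6))

Topic: MathematicalPhysics / KineticTheory. A brick of the convergence half of the named fact
`Literature.MathematicalPhysics.KineticTheory.illner_pulvirenti` (global validity of the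
Boltzmann equation for a rare gas cloud in all space; Cercignani–Illner–Pulvirenti 1994
Thm 4.5.1, Step 3 of its proof; Illner–Pulvirenti 1986/1989): the concrete hypotheses `htr`
(transports) and `hop` (collision operators) of the abstract global chain estimate
`abs_duhamelChain_le_dispersive_of_le` (`IllnerPulvirentiChainEstimate`) for the BOLTZMANN
hierarchy (`ε = 0`) on the whole space `ℝ^d`, with the dispersive factor of the rare cloud

  `Dsp_τ(Z_s) = exp(-β₀ ∑_i |x_i - τ v_i|²) = exp(-β₀ I(T^{-τ} Z_s))`   (CIP 1994 (5.4), `I(Z) = ∑ |x_i|²`).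

* `sum_norm_sq_sub_smul_appendParticle`, `sum_norm_sq_sub_smul_update`,
  `sum_norm_sq_sub_smul_lossConfig`, `sum_norm_sq_sub_smul_gainConfig` — the bookkeeping of
  `I(T^{-τ} ·)` in the collision configurations at `ε = 0`: the added particle sits at `x_i`,
  and for the gain configuration the pair `(v_i*, v*)` has the same `|x_i - τ v_i*|² + |x_i - τ v*|²`
  as `(v_i, v)` (momentum and energy conservation, `norm_sq_sub_smul_collide_add`; CIP (5.3)–(5.5));
* `abs_hsCollisionIntegrand_le_dispersive` — the pointwise bound on the gain and loss integrands
  under `|g| ≤ K Dsp_τ e^{-b H}`;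
* `integral_norm_add_mul_exp_mul_exp_dispersion_le` — the velocity integral
  `∫ (|v| + a) e^{-(b/2)|v|²} e^{-β₀|Y - τv|²} dv ≤ (b^{-1/2} + a) b^{-d/2} A(τ)`,
  `A(τ) = 2^d (2^d G₁ + b_max^{d/2} G_{β₀}) / (1 + τ)^d` for `0 < b ≤ b_max` (the moment
  `|v| e^{-(b/4)|v|²} ≤ b^{-1/2}` and the dispersion decay `integral_exp_mul_exp_dispersion_le`
  of CIP (5.6); `G_c = ∫ e^{-c|u|²} du`);
* `abs_boltzmannHierarchyOp_le_dispersive`, `abs_boltzmannHOp_le_dispersive` — the single-step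
  estimate: `|C⁰_{k,k+1} g (Z_k)| ≤ |S^{d-1}| A(τ) b^{-d/2} (k b^{-1/2} + ∑ |v_i|) K Dsp_τ(Z_k) e^{-b H(Z_k)}`
  (the shape of hypothesis `hop` of `abs_duhamelChain_le_dispersive_of_le`);
* `abs_freeTransport_le_dispersive` — free transport carries `Dsp_τ` to `Dsp_t` exactly
  (hypothesis `htr`).

Theorems only; positions and velocities in `ℝ^d = EuclideanSpace ℝ d`, geometry
`Euclidean.geometry d`.

## References

* C. Cercignani, R. Illner, M. Pulvirenti, *The Mathematical Theory of Dilute Gases*, Applied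
  Mathematical Sciences 106, Springer (1994), §4.5, proof of Thm 4.5.1, Step 3, (5.2)–(5.7),
  pp. 88–90 (and the last paragraph of the proof, p. 90: "The same argument, with some
  simplifications, can be used to obtain a bound for the series solution of the Boltzmann
  hierarchy").
* R. Illner, M. Pulvirenti, Comm. Math. Phys. 105 (1986) 189–203; 121 (1989) 143–146.
-/

open MeasureTheory Metric Real Set Filter Topology
open scoped InnerProductSpace ENNReal Nat
open Literature.Analysis.FluidPDE

namespace Literature.MathematicalPhysics.KineticTheory

noncomputable section

variable {d : Type*} [Fintype d]

/-! ## `I(T^{-τ} ·)` in the collision configurations -/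

section DispersiveSums

variable {s : ℕ}

omit [Fintype d] in
/-- Adjoining a particle `(x, v)` adds `|x - τv|²` to `∑ |x_j - τ v_j|²`. [folklore] -/
theorem sum_norm_sq_sub_smul_appendParticle [Fintype d] (Zs : Config s d (EuclideanSpace ℝ d))
    (x v : EuclideanSpace ℝ d) (τ : ℝ) :
    ∑ j, ‖(appendParticle Zs x v j).1 - τ • (appendParticle Zs x v j).2‖ ^ 2 =
      (∑ j, ‖(Zs j).1 - τ • (Zs j).2‖ ^ 2) + ‖x - τ • v‖ ^ 2 := by
  simp only [Fin.sum_univ_castSucc, appendParticle_apply_castSucc, appendParticle_apply_last]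

omit [Fintype d] in
/-- Replacing particle `i` by `p` changes `∑ |x_j - τ v_j|²` by the difference of the `i`-th
terms. [folklore] -/
theorem sum_norm_sq_sub_smul_update [Fintype d] (Zs : Config s d (EuclideanSpace ℝ d)) (i : Fin s)
    (p : EuclideanSpace ℝ d × EuclideanSpace ℝ d) (τ : ℝ) :
    (∑ j, ‖(Function.update Zs i p j).1 - τ • (Function.update Zs i p j).2‖ ^ 2) +
        ‖(Zs i).1 - τ • (Zs i).2‖ ^ 2 =
      (∑ j, ‖(Zs j).1 - τ • (Zs j).2‖ ^ 2) + ‖p.1 - τ • p.2‖ ^ 2 := by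
  have h1 : ∑ j, ‖(Function.update Zs i p j).1 - τ • (Function.update Zs i p j).2‖ ^ 2 =
      ‖p.1 - τ • p.2‖ ^ 2 + ∑ j ∈ Finset.univ \ {i}, ‖(Zs j).1 - τ • (Zs j).2‖ ^ 2 := by
    have := Finset.sum_update_of_mem (Finset.mem_univ i)
      (fun j => ‖(Zs j).1 - τ • (Zs j).2‖ ^ 2) (‖p.1 - τ • p.2‖ ^ 2)
    rw [← this]
    refine Finset.sum_congr rfl fun j _ => ?_
    rw [Function.apply_update (fun _ q => ‖q.1 - τ • q.2‖ ^ 2) Zs i p j]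
  have h2 : ∑ j, ‖(Zs j).1 - τ • (Zs j).2‖ ^ 2 =
      ‖(Zs i).1 - τ • (Zs i).2‖ ^ 2 + ∑ j ∈ Finset.univ \ {i}, ‖(Zs j).1 - τ • (Zs j).2‖ ^ 2 :=
    Finset.sum_eq_add_sum_sdiff_singleton_of_mem (Finset.mem_univ i) _
  rw [h1, h2]
  ring

/-- In the loss configuration of `C^{0,i}_{s,s+1}` (`ε = 0`, whole space) the added particle
sits at `x_i` with velocity `v`: `I_τ(loss) = I_τ(Z_s) + |x_i - τv|²`. [cite: CIP1994, §4.5 (5.3)] -/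
theorem sum_norm_sq_sub_smul_lossConfig (Zs : Config s d (EuclideanSpace ℝ d)) (i : Fin s)
    (ω v : EuclideanSpace ℝ d) (τ : ℝ) :
    ∑ j, ‖(lossConfig (Euclidean.geometry d) 0 Zs i ω v j).1 -
        τ • (lossConfig (Euclidean.geometry d) 0 Zs i ω v j).2‖ ^ 2 =
      (∑ j, ‖(Zs j).1 - τ • (Zs j).2‖ ^ 2) + ‖(Zs i).1 - τ • v‖ ^ 2 := by
  rw [lossConfig_zero, sum_norm_sq_sub_smul_appendParticle]

/-- In the gain configuration of `C^{0,i}_{s,s+1}` (`ε = 0`, whole space) the pair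
`(v_i*, v*)` replaces `(v_i, v)` at the common position `x_i`; since
`|x_i - τ v_i*|² + |x_i - τ v*|² = |x_i - τ v_i|² + |x_i - τ v|²` (momentum and energy
conservation, `norm_sq_sub_smul_collide_add`), `I_τ(gain) = I_τ(Z_s) + |x_i - τv|²`
(CIP 1994 §4.5 (5.3)–(5.5)). [cite: CIP1994, §4.5 (5.3)–(5.5)] -/
theorem sum_norm_sq_sub_smul_gainConfig (Zs : Config s d (EuclideanSpace ℝ d)) (i : Fin s)
    (ω : sphere (0 : EuclideanSpace ℝ d) 1) (v : EuclideanSpace ℝ d) (τ : ℝ) :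
    ∑ j, ‖(gainConfig (Euclidean.geometry d) 0 Zs i ω v j).1 -
        τ • (gainConfig (Euclidean.geometry d) 0 Zs i ω v j).2‖ ^ 2 =
      (∑ j, ‖(Zs j).1 - τ • (Zs j).2‖ ^ 2) + ‖(Zs i).1 - τ • v‖ ^ 2 := by
  rw [gainConfig_zero, sum_norm_sq_sub_smul_appendParticle]
  have h := sum_norm_sq_sub_smul_update Zs i
    ((Zs i).1, (reflectVel (ω : EuclideanSpace ℝ d) ((Zs i).2, v)).1) τ
  have hpair := norm_sq_sub_smul_collide_add (Zs i).1 τ ω ((Zs i).2, v)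
  rw [← reflectVel_eq_collide] at hpair
  simp only at h hpair
  linarith

end DispersiveSums

/-! ## The pointwise bound on the collision integrand -/

section SingleStep

variable {s : ℕ}

/-- Pointwise bound on the integrand of `C^{0,i}_{s,s+1}` under the dispersive bound
`|g(Z)| ≤ K e^{-β₀ I_τ(Z)} e^{-b H(Z)}`:
`|(ω·(v - v_i))_+ g(gain)| + |(ω·(v - v_i))_- g(loss)| ≤
K e^{-β₀ I_τ(Z_s)} e^{-b H(Z_s)} · (|v| + |v_i|) e^{-(b/2)|v|²} e^{-β₀|x_i - τv|²}`
(CIP 1994 §4.5 (5.4)–(5.5)). [cite: CIP1994, §4.5 (5.4)–(5.5)] -/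
theorem abs_hsCollisionIntegrand_le_dispersive (i : Fin s) {K b β₀ τ : ℝ}
    {g : Config (s + 1) d (EuclideanSpace ℝ d) → ℝ}
    (hg : ∀ Z, |g Z| ≤ K * (exp (-β₀ * ∑ j, ‖(Z j).1 - τ • (Z j).2‖ ^ 2) *
      exp (-b * configEnergy Z)))
    (Zs : Config s d (EuclideanSpace ℝ d)) (ω : sphere (0 : EuclideanSpace ℝ d) 1)
    (v : EuclideanSpace ℝ d) :
    |max ⟪(ω : EuclideanSpace ℝ d), v - (Zs i).2⟫_ℝ 0 *
          g (gainConfig (Euclidean.geometry d) 0 Zs i ω v)| +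
        |max (-⟪(ω : EuclideanSpace ℝ d), v - (Zs i).2⟫_ℝ) 0 *
          g (lossConfig (Euclidean.geometry d) 0 Zs i ω v)| ≤
      (K * (exp (-β₀ * ∑ j, ‖(Zs j).1 - τ • (Zs j).2‖ ^ 2) * exp (-b * configEnergy Zs))) *
        ((‖v‖ + ‖(Zs i).2‖) * exp (-(b / 2) * ‖v‖ ^ 2) * exp (-β₀ * ‖(Zs i).1 - τ • v‖ ^ 2)) := by
  set A := ⟪(ω : EuclideanSpace ℝ d), v - (Zs i).2⟫_ℝ with hA
  set I := ∑ j, ‖(Zs j).1 - τ • (Zs j).2‖ ^ 2 with hI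
  set B := K * (exp (-β₀ * (I + ‖(Zs i).1 - τ • v‖ ^ 2)) *
    exp (-b * (configEnergy Zs + 2⁻¹ * ‖v‖ ^ 2))) with hB
  have hgain : |g (gainConfig (Euclidean.geometry d) 0 Zs i ω v)| ≤ B := by
    have h := hg (gainConfig (Euclidean.geometry d) 0 Zs i ω v)
    rwa [configEnergy_gainConfig, sum_norm_sq_sub_smul_gainConfig] at h
  have hloss : |g (lossConfig (Euclidean.geometry d) 0 Zs i ω v)| ≤ B := by
    have h := hg (lossConfig (Euclidean.geometry d) 0 Zs i ω v)
    rwa [configEnergy_lossConfig, sum_norm_sq_sub_smul_lossConfig] at h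
  have hB0 : 0 ≤ B := (abs_nonneg _).trans hgain
  have hApos : 0 ≤ max A 0 := le_max_right _ _
  have hAneg : 0 ≤ max (-A) 0 := le_max_right _ _
  have hsum : max A 0 + max (-A) 0 = |A| := by
    rcases le_total 0 A with h | h
    · rw [max_eq_left h, max_eq_right (by linarith), abs_of_nonneg h, add_zero]
    · rw [max_eq_right h, max_eq_left (by linarith), abs_of_nonpos h, zero_add]
  have hAle : |A| ≤ ‖v‖ + ‖(Zs i).2‖ := by
    calc |A| ≤ ‖(ω : EuclideanSpace ℝ d)‖ * ‖v - (Zs i).2‖ := abs_real_inner_le_norm _ _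
      _ = ‖v - (Zs i).2‖ := by rw [norm_eq_of_mem_sphere ω, one_mul]
      _ ≤ ‖v‖ + ‖(Zs i).2‖ := norm_sub_le _ _
  have hBexp : B = (K * (exp (-β₀ * I) * exp (-b * configEnergy Zs))) *
      (exp (-(b / 2) * ‖v‖ ^ 2) * exp (-β₀ * ‖(Zs i).1 - τ • v‖ ^ 2)) := by
    rw [hB, mul_add, exp_add, mul_add, exp_add]
    have : exp (-b * (2⁻¹ * ‖v‖ ^ 2)) = exp (-(b / 2) * ‖v‖ ^ 2) := by
      congr 1; ring
    rw [this]
    ring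
  calc |max A 0 * g (gainConfig (Euclidean.geometry d) 0 Zs i ω v)| +
        |max (-A) 0 * g (lossConfig (Euclidean.geometry d) 0 Zs i ω v)|
      = max A 0 * |g (gainConfig (Euclidean.geometry d) 0 Zs i ω v)| +
          max (-A) 0 * |g (lossConfig (Euclidean.geometry d) 0 Zs i ω v)| := by
        rw [abs_mul, abs_mul, abs_of_nonneg hApos, abs_of_nonneg hAneg]
    _ ≤ max A 0 * B + max (-A) 0 * B :=
        add_le_add (mul_le_mul_of_nonneg_left hgain hApos) (mul_le_mul_of_nonneg_left hloss hAneg)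
    _ = |A| * B := by rw [← add_mul, hsum]
    _ ≤ (‖v‖ + ‖(Zs i).2‖) * B := mul_le_mul_of_nonneg_right hAle hB0
    _ = _ := by rw [hBexp]; ring

/-! ## The velocity integral: moment and dispersion decay -/

/-- `(|v| + a) e^{-(b/4)|v|²} ≤ b^{-1/2} + a` for `b > 0`, `a ≥ 0`
(`UkaiLanford.mul_exp_neg_mul_sq_le`: `x e^{-(b/4) x²} ≤ 1/(2 (b/4)^{1/2}) = b^{-1/2}`). [folklore] -/
theorem norm_add_mul_exp_quarter_le {b : ℝ} (hb : 0 < b) {a : ℝ} (ha : 0 ≤ a)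
    (v : EuclideanSpace ℝ d) :
    (‖v‖ + a) * exp (-(b / 4) * ‖v‖ ^ 2) ≤ (sqrt b)⁻¹ + a := by
  have h1 := UkaiLanford.mul_exp_neg_mul_sq_le (a := b / 4) (by positivity) ‖v‖
  have h2 : (1 : ℝ) / (2 * sqrt (b / 4)) = (sqrt b)⁻¹ := by
    have : sqrt (b / 4) = sqrt b / 2 := by
      rw [show b / 4 = b / 2 ^ 2 by norm_num, sqrt_div' b (by norm_num : (0:ℝ) ≤ 2 ^ 2),
        sqrt_sq (by norm_num : (0:ℝ) ≤ 2)]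
    rw [this]
    field_simp
  rw [h2] at h1
  have h3 : exp (-(b / 4) * ‖v‖ ^ 2) ≤ 1 := exp_le_one_iff.2 (by nlinarith [sq_nonneg ‖v‖])
  rw [add_mul]
  exact add_le_add h1 (by nlinarith [mul_le_mul_of_nonneg_left h3 ha])

/-- Scaling of the Gaussian constant: `∫ e^{-(b/4)|u|²} du = (2/b^{1/2})^d ∫ e^{-|w|²} dw`
(`Measure.integral_comp_smul` with `w = (b^{1/2}/2) u`). [folklore] -/
theorem integral_exp_neg_quarter_mul_sq_norm {b : ℝ} (hb : 0 < b) :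
    ∫ u : EuclideanSpace ℝ d, exp (-(b / 4) * ‖u‖ ^ 2) =
      (sqrt b ^ Fintype.card d)⁻¹ * 2 ^ Fintype.card d *
        ∫ w : EuclideanSpace ℝ d, exp (-‖w‖ ^ 2) := by
  have hsq : 0 < sqrt b := sqrt_pos.2 hb
  set R : ℝ := sqrt b / 2 with hR
  have hR0 : 0 < R := by positivity
  have hcomp : (fun u : EuclideanSpace ℝ d => exp (-(b / 4) * ‖u‖ ^ 2)) =
      fun u => (fun w : EuclideanSpace ℝ d => exp (-‖w‖ ^ 2)) (R • u) := by
    funext u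
    simp only [norm_smul, Real.norm_eq_abs, abs_of_pos hR0, mul_pow]
    congr 1
    have hR2 : R ^ 2 = b / 4 := by rw [hR, div_pow, sq_sqrt hb.le]; norm_num
    rw [hR2]
    ring
  rw [hcomp, Measure.integral_comp_smul_of_nonneg (μ := volume)
    (fun w : EuclideanSpace ℝ d => exp (-‖w‖ ^ 2)) R (hR := hR0.le), finrank_euclideanSpace,
    smul_eq_mul]
  congr 1
  rw [hR, div_pow, inv_div, div_eq_mul_inv, mul_comm]

/-- **The velocity integral of one dispersive collision operator** (CIP 1994 §4.5 (5.5)–(5.6)):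
for `0 < b ≤ b_max`, `a ≥ 0`, `β₀ > 0`, `τ ≥ 0` and every `Y`,
`∫ (|v| + a) e^{-(b/2)|v|²} e^{-β₀|Y - τv|²} dv ≤ (b^{-1/2} + a) b^{-d/2} A(τ)`,
`A(τ) = 2^d (2^d G₁ + b_max^{d/2} G_{β₀}) / (1 + τ)^d`, `G₁ = ∫ e^{-|w|²} dw`,
`G_{β₀} = ∫ e^{-β₀|w|²} dw`: the moment `(|v| + a) e^{-(b/4)|v|²} ≤ b^{-1/2} + a` and the
dispersion decay `integral_exp_mul_exp_dispersion_le` for the remaining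
`∫ e^{-(b/4)|v|²} e^{-β₀|Y - τv|²} dv`. [cite: CIP1994, §4.5 (5.5)–(5.6)] -/
theorem integral_norm_add_mul_exp_mul_exp_dispersion_le {b bmax β₀ : ℝ} (hb : 0 < b)
    (hbmax : b ≤ bmax) (hβ₀ : 0 < β₀) {a : ℝ} (ha : 0 ≤ a) (Y : EuclideanSpace ℝ d) {τ : ℝ}
    (hτ : 0 ≤ τ) :
    ∫ v : EuclideanSpace ℝ d,
        (‖v‖ + a) * exp (-(b / 2) * ‖v‖ ^ 2) * exp (-β₀ * ‖Y - τ • v‖ ^ 2) ≤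
      ((sqrt b)⁻¹ + a) * (sqrt b ^ Fintype.card d)⁻¹ *
        (2 ^ Fintype.card d * (2 ^ Fintype.card d * (∫ w : EuclideanSpace ℝ d, exp (-‖w‖ ^ 2)) +
            sqrt bmax ^ Fintype.card d * ∫ w : EuclideanSpace ℝ d, exp (-β₀ * ‖w‖ ^ 2)) /
          (1 + τ) ^ Fintype.card d) := by
  set D : ℕ := Fintype.card d with hD
  set G₁ : ℝ := ∫ w : EuclideanSpace ℝ d, exp (-‖w‖ ^ 2) with hG₁
  set Gβ : ℝ := ∫ w : EuclideanSpace ℝ d, exp (-β₀ * ‖w‖ ^ 2) with hGβ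
  have hG₁0 : 0 ≤ G₁ := integral_nonneg fun w => (exp_pos _).le
  have hGβ0 : 0 ≤ Gβ := integral_nonneg fun w => (exp_pos _).le
  have hsq : 0 < sqrt b := sqrt_pos.2 hb
  have hsa : 0 ≤ (sqrt b)⁻¹ + a := by positivity
  -- the upper function and its integrability
  set h : EuclideanSpace ℝ d → ℝ := fun v =>
    exp (-(b / 4) * ‖v‖ ^ 2) * exp (-β₀ * ‖Y - τ • v‖ ^ 2) with hh
  have hhi : Integrable h := by
    refine (Literature.Analysis.FluidPDE.integrable_exp_neg_mul_sq_norm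
      (b := b / 4) (by positivity)).mono' ?_ (Eventually.of_forall fun v => ?_)
    · exact (by fun_prop : Continuous h).aestronglyMeasurable
    · simp only [hh]
      rw [Real.norm_of_nonneg (by positivity)]
      have : exp (-β₀ * ‖Y - τ • v‖ ^ 2) ≤ 1 :=
        exp_le_one_iff.2 (by nlinarith [sq_nonneg ‖Y - τ • v‖])
      calc exp (-(b / 4) * ‖v‖ ^ 2) * exp (-β₀ * ‖Y - τ • v‖ ^ 2)
          ≤ exp (-(b / 4) * ‖v‖ ^ 2) * 1 := mul_le_mul_of_nonneg_left this (exp_pos _).le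
        _ = exp (-(b / 4) * ‖v‖ ^ 2) := mul_one _
  -- pointwise comparison
  have hpt : ∀ v : EuclideanSpace ℝ d,
      (‖v‖ + a) * exp (-(b / 2) * ‖v‖ ^ 2) * exp (-β₀ * ‖Y - τ • v‖ ^ 2) ≤
        ((sqrt b)⁻¹ + a) * h v := fun v => by
    have hsplit : exp (-(b / 2) * ‖v‖ ^ 2) =
        exp (-(b / 4) * ‖v‖ ^ 2) * exp (-(b / 4) * ‖v‖ ^ 2) := by
      rw [← exp_add]; congr 1; ring
    have hm := norm_add_mul_exp_quarter_le hb ha v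
    simp only [hh]
    rw [hsplit]
    have h0 : 0 ≤ exp (-(b / 4) * ‖v‖ ^ 2) * exp (-β₀ * ‖Y - τ • v‖ ^ 2) := by positivity
    calc (‖v‖ + a) * (exp (-(b / 4) * ‖v‖ ^ 2) * exp (-(b / 4) * ‖v‖ ^ 2)) *
          exp (-β₀ * ‖Y - τ • v‖ ^ 2)
        = ((‖v‖ + a) * exp (-(b / 4) * ‖v‖ ^ 2)) *
            (exp (-(b / 4) * ‖v‖ ^ 2) * exp (-β₀ * ‖Y - τ • v‖ ^ 2)) := by ring
      _ ≤ ((sqrt b)⁻¹ + a) * (exp (-(b / 4) * ‖v‖ ^ 2) * exp (-β₀ * ‖Y - τ • v‖ ^ 2)) :=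
          mul_le_mul_of_nonneg_right hm h0
  -- the dispersion decay for `h`
  have hdisp : ∫ v, h v ≤ 2 ^ D * ((∫ u : EuclideanSpace ℝ d, exp (-(b / 4) * ‖u‖ ^ 2)) + Gβ) /
      (1 + τ) ^ D := by
    have h1 := integral_exp_mul_exp_dispersion_le (E := EuclideanSpace ℝ d) (a := b / 4)
      (b := β₀) (by positivity) hβ₀ Y hτ
    rw [finrank_euclideanSpace] at h1
    exact h1
  have hquarter : (∫ u : EuclideanSpace ℝ d, exp (-(b / 4) * ‖u‖ ^ 2)) =
      (sqrt b ^ D)⁻¹ * 2 ^ D * G₁ := integral_exp_neg_quarter_mul_sq_norm hb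
  -- `G_{β₀} ≤ b^{-d/2} b_max^{d/2} G_{β₀}`
  have hGβ' : Gβ ≤ (sqrt b ^ D)⁻¹ * (sqrt bmax ^ D * Gβ) := by
    have hpow : sqrt b ^ D ≤ sqrt bmax ^ D :=
      pow_le_pow_left₀ hsq.le (sqrt_le_sqrt hbmax) D
    have hbD : 0 < sqrt b ^ D := pow_pos hsq D
    calc Gβ = (sqrt b ^ D)⁻¹ * (sqrt b ^ D * Gβ) := by field_simp
      _ ≤ (sqrt b ^ D)⁻¹ * (sqrt bmax ^ D * Gβ) := by gcongr
  have h1τ : 0 < (1 + τ) ^ D := pow_pos (by linarith) D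
  have hBinv : 0 ≤ (sqrt b ^ D)⁻¹ := inv_nonneg.2 (pow_nonneg hsq.le D)
  calc ∫ v : EuclideanSpace ℝ d,
        (‖v‖ + a) * exp (-(b / 2) * ‖v‖ ^ 2) * exp (-β₀ * ‖Y - τ • v‖ ^ 2)
      ≤ ∫ v, ((sqrt b)⁻¹ + a) * h v :=
        integral_mono_of_nonneg (Eventually.of_forall fun v => by positivity) (hhi.const_mul _)
          (Eventually.of_forall hpt)
    _ = ((sqrt b)⁻¹ + a) * ∫ v, h v := integral_const_mul _ _
    _ ≤ ((sqrt b)⁻¹ + a) *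
          (2 ^ D * ((∫ u : EuclideanSpace ℝ d, exp (-(b / 4) * ‖u‖ ^ 2)) + Gβ) / (1 + τ) ^ D) :=
        mul_le_mul_of_nonneg_left hdisp hsa
    _ ≤ ((sqrt b)⁻¹ + a) *
          (2 ^ D * ((sqrt b ^ D)⁻¹ * 2 ^ D * G₁ + (sqrt b ^ D)⁻¹ * (sqrt bmax ^ D * Gβ)) /
            (1 + τ) ^ D) := by
        rw [hquarter]
        gcongr
    _ = ((sqrt b)⁻¹ + a) * (sqrt b ^ D)⁻¹ *
          (2 ^ D * (2 ^ D * G₁ + sqrt bmax ^ D * Gβ) / (1 + τ) ^ D) := by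
        ring

/-- `ψ(v) = (|v| + a) e^{-(b/2)|v|²} e^{-β₀|Y - τv|²}` is integrable (`b > 0`). [folklore] -/
theorem integrable_norm_add_mul_exp_mul_exp {b : ℝ} (hb : 0 < b) {a : ℝ} (ha : 0 ≤ a) (β₀ : ℝ)
    (hβ₀ : 0 ≤ β₀) (Y : EuclideanSpace ℝ d) (τ : ℝ) :
    Integrable fun v : EuclideanSpace ℝ d =>
      (‖v‖ + a) * exp (-(b / 2) * ‖v‖ ^ 2) * exp (-β₀ * ‖Y - τ • v‖ ^ 2) := by
  refine (integrable_norm_add_mul_exp hb a ha).mono' ?_ (Eventually.of_forall fun v => ?_)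
  · exact (by fun_prop : Continuous fun v : EuclideanSpace ℝ d =>
      (‖v‖ + a) * exp (-(b / 2) * ‖v‖ ^ 2) * exp (-β₀ * ‖Y - τ • v‖ ^ 2)).aestronglyMeasurable
  · rw [Real.norm_of_nonneg (by positivity)]
    have : exp (-β₀ * ‖Y - τ • v‖ ^ 2) ≤ 1 :=
      exp_le_one_iff.2 (by nlinarith [sq_nonneg ‖Y - τ • v‖])
    calc (‖v‖ + a) * exp (-(b / 2) * ‖v‖ ^ 2) * exp (-β₀ * ‖Y - τ • v‖ ^ 2)
        ≤ (‖v‖ + a) * exp (-(b / 2) * ‖v‖ ^ 2) * 1 :=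
          mul_le_mul_of_nonneg_left this (by positivity)
      _ = (‖v‖ + a) * exp (-(b / 2) * ‖v‖ ^ 2) := mul_one _

/-! ## The single-step estimate for `C⁰_{k,k+1}` with the travelling Maxwellian -/

/-- **Dispersive estimate for one elementary Boltzmann-hierarchy collision operator**
`C^{0,i}_{s,s+1}` on `ℝ^d` (CIP 1994 §4.5 (5.2)–(5.7)): for `0 < b ≤ b_max`, `β₀ > 0`, `τ ≥ 0`,
`K ≥ 0` and `|g(Z)| ≤ K e^{-β₀ I_τ(Z)} e^{-b H(Z)}`,
`|C^{0,i}_{s,s+1} g (Z_s)| ≤ |S^{d-1}| A(τ) b^{-d/2} (b^{-1/2} + |v_i|) K e^{-β₀ I_τ(Z_s)} e^{-b H(Z_s)}`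
with `A(τ) = 2^d (2^d G₁ + b_max^{d/2} G_{β₀}) / (1 + τ)^d`. [cite: CIP1994, §4.5 (5.2)–(5.7)] -/
theorem abs_boltzmannHierarchyOp_le_dispersive (i : Fin s) {K b bmax β₀ τ : ℝ} (hb : 0 < b)
    (hbmax : b ≤ bmax) (hβ₀ : 0 < β₀) (hτ : 0 ≤ τ) (hK : 0 ≤ K)
    {g : Config (s + 1) d (EuclideanSpace ℝ d) → ℝ}
    (hg : ∀ Z, |g Z| ≤ K * (exp (-β₀ * ∑ j, ‖(Z j).1 - τ • (Z j).2‖ ^ 2) *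
      exp (-b * configEnergy Z)))
    (Zs : Config s d (EuclideanSpace ℝ d)) :
    |boltzmannHierarchyOp (Euclidean.geometry d) s i g Zs| ≤
      ((KineticTheory.sphereMeasure : Measure (sphere (0 : EuclideanSpace ℝ d) 1)).real univ *
          (2 ^ Fintype.card d *
              (2 ^ Fintype.card d * (∫ w : EuclideanSpace ℝ d, exp (-‖w‖ ^ 2)) +
                sqrt bmax ^ Fintype.card d * ∫ w : EuclideanSpace ℝ d, exp (-β₀ * ‖w‖ ^ 2)) /
            (1 + τ) ^ Fintype.card d)) *
        (sqrt b ^ Fintype.card d)⁻¹ * ((sqrt b)⁻¹ + ‖(Zs i).2‖) *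
        (K * (exp (-β₀ * ∑ j, ‖(Zs j).1 - τ • (Zs j).2‖ ^ 2) * exp (-b * configEnergy Zs))) := by
  haveI := Literature.Analysis.FluidPDE.isFiniteMeasure_sphereMeasure (E := EuclideanSpace ℝ d)
  set D : ℕ := Fintype.card d with hD
  set Aτ : ℝ := 2 ^ D * (2 ^ D * (∫ w : EuclideanSpace ℝ d, exp (-‖w‖ ^ 2)) +
      sqrt bmax ^ D * ∫ w : EuclideanSpace ℝ d, exp (-β₀ * ‖w‖ ^ 2)) / (1 + τ) ^ D with hAτ
  set S : ℝ := (KineticTheory.sphereMeasure : Measure (sphere (0 : EuclideanSpace ℝ d) 1)).real univ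
    with hS
  set M : ℝ := K * (exp (-β₀ * ∑ j, ‖(Zs j).1 - τ • (Zs j).2‖ ^ 2) * exp (-b * configEnergy Zs))
    with hM
  have hM0 : 0 ≤ M := by positivity
  set ψ : EuclideanSpace ℝ d → ℝ := fun v =>
    (‖v‖ + ‖(Zs i).2‖) * exp (-(b / 2) * ‖v‖ ^ 2) * exp (-β₀ * ‖(Zs i).1 - τ • v‖ ^ 2) with hψ
  have hψi : Integrable ψ :=
    integrable_norm_add_mul_exp_mul_exp hb (norm_nonneg _) β₀ hβ₀.le (Zs i).1 τ
  have hψle : ∫ v, ψ v ≤ ((sqrt b)⁻¹ + ‖(Zs i).2‖) * (sqrt b ^ D)⁻¹ * Aτ :=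
    integral_norm_add_mul_exp_mul_exp_dispersion_le hb hbmax hβ₀ (norm_nonneg _) (Zs i).1 hτ
  -- the inner (velocity) integrals
  have hinner : ∀ ω : sphere (0 : EuclideanSpace ℝ d) 1,
      ‖∫ v : EuclideanSpace ℝ d,
          (max ⟪(ω : EuclideanSpace ℝ d), v - (Zs i).2⟫_ℝ 0 *
              g (gainConfig (Euclidean.geometry d) 0 Zs i ω v) -
            max (-⟪(ω : EuclideanSpace ℝ d), v - (Zs i).2⟫_ℝ) 0 *
              g (lossConfig (Euclidean.geometry d) 0 Zs i ω v))‖ ≤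
        M * ∫ v, ψ v := fun ω =>
    (norm_integral_le_of_norm_le (hψi.const_mul M) (Eventually.of_forall fun v => by
      rw [Real.norm_eq_abs]
      exact (abs_sub _ _).trans (abs_hsCollisionIntegrand_le_dispersive i hg Zs ω v))).trans_eq
      (integral_const_mul _ _)
  -- the outer (impact direction) integral
  have hout : |boltzmannHierarchyOp (Euclidean.geometry d) s i g Zs| ≤ (M * ∫ v, ψ v) * S := by
    rw [← Real.norm_eq_abs]
    unfold Literature.Analysis.FluidPDE.boltzmannHierarchyOp Literature.Analysis.FluidPDE.hsCollisionTerm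
    calc _ ≤ ∫ _ω, (M * ∫ v, ψ v) ∂KineticTheory.sphereMeasure :=
          norm_integral_le_of_norm_le (integrable_const _) (Eventually.of_forall hinner)
      _ = (M * ∫ v, ψ v) * S := by rw [integral_const, smul_eq_mul, mul_comm]
  have hS0 : 0 ≤ S := measureReal_nonneg
  calc |boltzmannHierarchyOp (Euclidean.geometry d) s i g Zs| ≤ (M * ∫ v, ψ v) * S := hout
    _ ≤ (M * (((sqrt b)⁻¹ + ‖(Zs i).2‖) * (sqrt b ^ D)⁻¹ * Aτ)) * S := by gcongr
    _ = (S * Aτ) * (sqrt b ^ D)⁻¹ * ((sqrt b)⁻¹ + ‖(Zs i).2‖) * M := by ring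

/-- **Dispersive single-step estimate for the Boltzmann hierarchy collision operator**
`C⁰_{k,k+1} = ∑_{i<k} C^{0,i}_{k,k+1}` on `ℝ^d` — hypothesis `hop` of
`abs_duhamelChain_le_dispersive_of_le` with `A(τ) = |S^{d-1}| 2^d (2^d G₁ + b_max^{d/2} G_{β₀}) / (1+τ)^d`:
`|C⁰_{k,k+1} g (Z_k)| ≤ A(τ) b^{-d/2} (k b^{-1/2} + ∑ |v_i|) K e^{-β₀ I_τ(Z_k)} e^{-b H(Z_k)}`
(CIP 1994 §4.5 (5.2)–(5.7)). [cite: CIP1994, §4.5 (5.2)–(5.7)] -/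
theorem abs_boltzmannHOp_le_dispersive (s : ℕ) {K b bmax β₀ τ : ℝ} (hb : 0 < b)
    (hbmax : b ≤ bmax) (hβ₀ : 0 < β₀) (hτ : 0 ≤ τ) (hK : 0 ≤ K)
    {g : Config (s + 1) d (EuclideanSpace ℝ d) → ℝ}
    (hg : ∀ Z, |g Z| ≤ K * (exp (-β₀ * ∑ j, ‖(Z j).1 - τ • (Z j).2‖ ^ 2) *
      exp (-b * configEnergy Z)))
    (Zs : Config s d (EuclideanSpace ℝ d)) :
    |boltzmannHOp (Euclidean.geometry d) s g Zs| ≤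
      ((KineticTheory.sphereMeasure : Measure (sphere (0 : EuclideanSpace ℝ d) 1)).real univ *
          (2 ^ Fintype.card d *
              (2 ^ Fintype.card d * (∫ w : EuclideanSpace ℝ d, exp (-‖w‖ ^ 2)) +
                sqrt bmax ^ Fintype.card d * ∫ w : EuclideanSpace ℝ d, exp (-β₀ * ‖w‖ ^ 2)) /
            (1 + τ) ^ Fintype.card d)) *
        (sqrt b ^ Fintype.card d)⁻¹ * (s * (sqrt b)⁻¹ + ∑ i, ‖(Zs i).2‖) *
        (K * (exp (-β₀ * ∑ j, ‖(Zs j).1 - τ • (Zs j).2‖ ^ 2) * exp (-b * configEnergy Zs))) := by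
  unfold Literature.Analysis.FluidPDE.boltzmannHOp
  calc |∑ i : Fin s, boltzmannHierarchyOp (Euclidean.geometry d) s i g Zs|
      ≤ ∑ i : Fin s, |boltzmannHierarchyOp (Euclidean.geometry d) s i g Zs| :=
        Finset.abs_sum_le_sum_abs _ _
    _ ≤ ∑ i : Fin s,
        ((KineticTheory.sphereMeasure : Measure (sphere (0 : EuclideanSpace ℝ d) 1)).real univ *
          (2 ^ Fintype.card d *
              (2 ^ Fintype.card d * (∫ w : EuclideanSpace ℝ d, exp (-‖w‖ ^ 2)) +
                sqrt bmax ^ Fintype.card d * ∫ w : EuclideanSpace ℝ d, exp (-β₀ * ‖w‖ ^ 2)) /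
            (1 + τ) ^ Fintype.card d)) *
        (sqrt b ^ Fintype.card d)⁻¹ * ((sqrt b)⁻¹ + ‖(Zs i).2‖) *
        (K * (exp (-β₀ * ∑ j, ‖(Zs j).1 - τ • (Zs j).2‖ ^ 2) * exp (-b * configEnergy Zs))) :=
        Finset.sum_le_sum fun i _ =>
          abs_boltzmannHierarchyOp_le_dispersive i hb hbmax hβ₀ hτ hK hg Zs
    _ = _ := by
        rw [← Finset.sum_mul, ← Finset.mul_sum, Finset.sum_add_distrib, Finset.sum_const,
          Finset.card_univ, Fintype.card_fin, nsmul_eq_mul]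

/-! ## Free transport carries the dispersive weight -/

/-- **Free transport carries `Dsp_τ` to `Dsp_t`** — hypothesis `htr` of
`abs_duhamelChain_le_dispersive_of_le` for the Boltzmann hierarchy on `ℝ^d`: if
`|g(Z)| ≤ K e^{-β₀ I_τ(Z)} e^{-b H(Z)}` then `|T_s(t - τ) g (Z)| ≤ K e^{-β₀ I_t(Z)} e^{-b H(Z)}`
(indeed `I_τ(S_{-(t-τ)} Z) = I_t(Z)` and the kinetic energy is unchanged; CIP 1994 §4.5 (5.2)).
[cite: CIP1994, §4.5 (5.2)] -/
theorem abs_freeTransport_le_dispersive (s : ℕ) (b β₀ τ t : ℝ)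
    (g : Config s d (EuclideanSpace ℝ d) → ℝ) (K : ℝ)
    (hg : ∀ Z, |g Z| ≤ K * (exp (-β₀ * ∑ j, ‖(Z j).1 - τ • (Z j).2‖ ^ 2) *
      exp (-b * configEnergy Z)))
    (Z : Config s d (EuclideanSpace ℝ d)) :
    |freeTransport (Euclidean.geometry d) s (t - τ) g Z| ≤
      K * (exp (-β₀ * ∑ j, ‖(Z j).1 - t • (Z j).2‖ ^ 2) * exp (-b * configEnergy Z)) := by
  rw [freeTransport_apply]
  have h := hg (freeFlight (Euclidean.geometry d) (-(t - τ)) Z)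
  rw [configEnergy_freeFlight] at h
  have hsum : ∑ j, ‖(freeFlight (Euclidean.geometry d) (-(t - τ)) Z j).1 -
      τ • (freeFlight (Euclidean.geometry d) (-(t - τ)) Z j).2‖ ^ 2 =
      ∑ j, ‖(Z j).1 - t • (Z j).2‖ ^ 2 := by
    refine Finset.sum_congr rfl fun j _ => ?_
    simp only [freeFlight_apply, Euclidean.geometry_translate]
    congr 2
    rw [neg_smul, sub_smul]
    abel
  rwa [hsum] at h

end SingleStep

end

end Literature.MathematicalPhysics.KineticTheory
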